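import Literature.AlgebraicGeometry.HodgeTheory.MaxRationalSubHodgeStructureHodgeNumberBound
import HarnessLib

/-!
# Gysin images from lower-dimensional varieties raise the coniveau: for `f : Y ⟶ X` with
# `dim Y + s = dim X`, `f_*` has bidegree `(s, s)`, maps admissible subspaces of `(Hᵃ(Y), Fᶜ)` to admissible
# subspaces of `(Hᵇ(X), F^{c+s})`, and `im f_* ⊆ Hᵇ(X(ℂ); ℂ)` is a rational sub-Hodge structure of Hodge
# coniveau `≥ s` (Voisin 2025, §4.1)

Family `hodge`, layer `Literature/AlgebraicGeometry/HodgeTheory`; lane `lit-hodgefound` (Track 2 foundations,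
Layer A1/A4). THEOREMS ONLY (no definition, no named fact; D-0026).

Voisin (J. Open Math. Probl. 1 (2025), §4.1, PDF p. 24): «Let `Y` be a smooth complex projective variety, with
`dim Y = dim X − c`, and let `φ : Y → X` be a morphism (i.e. a holomorphic map). Then
`φ_* : H^{k−2c}(Y, ℚ) → Hᵏ(X, ℚ)` is a morphism of Hodge structures, that maps `H^{p,q}(Y)` to
`H^{p+c,q+c}(X)`. It follows that `L := Im φ_* ⊂ Hᵏ(X, ℚ)` is a Hodge substructure with `L^{p′,q′} = 0` if
`p′ < c` or `q′ < c`. Hence `L` has Hodge coniveau `≥ c`.»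

This is the companion of the tree's `MaxRationalSubHodgeStructureFunctoriality` §2, which treats the Gysin
morphism of `g : X ⟶ W` with `dim X = dim W + r` (bidegree `(−r, −r)`, shift `(a, c + r) ↦ (b, c)`). Here
`f : Y ⟶ X` with `dim Y + s = dim X` and `f_* : Hᵃ(Y(ℂ); ℂ) → Hᵇ(X(ℂ); ℂ)`, `b = a + 2s`
(`complexGysin complexOrientationFamily`, real Gysin morphisms of the complex orientations):

* §1 **`isOfHodgeType_complexGysin_of_add_eq_dim`** — `f_*` has bidegree `(s, s)`: type `(p, q)` on `Y` goes to
  type `(p + s, q + s)` on `X` (the tree's unconditional `isOfHodgeType_complexGysin_of_cupPreservesHodgeType`).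
* §2 **`HodgeModel.IsSubHodge.map_complexGysin_of_add_eq_dim`** (sub-Hodge ↦ sub-Hodge),
  **`HodgeModel.map_complexGysin_hodgeFiltrationBetti_le_of_add_eq_dim`** (`f_* Fᶜ Hᵃ(Y) ⊆ F^{c+s} Hᵇ(X)`),
  **`HodgeModel.complexGysin_map_mem_ratSubHodgeInFilt_of_add_eq_dim`** (admissible for `(Hᵃ(Y), Fᶜ)` ↦
  admissible for `(Hᵇ(X), F^{c+s})`) and **`HodgeModel.map_complexGysin_maxRatSubHodgeInFilt_le_of_add_eq_dim`**
  (`f_* max_Y(a, c) ≤ max_X(b, c + s)`).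
* §3 VOISIN'S SENTENCE: **`HodgeModel.range_complexGysin_mem_ratSubHodgeInFilt`** — `im f_* = f_* Hᵃ(Y(ℂ); ℂ)`
  is an admissible subspace of `(Hᵇ(X), Fˢ)`: rationally spanned, a sub-Hodge structure, of Hodge coniveau
  `≥ s`; hence **`HodgeModel.range_complexGysin_le_maxRatSubHodgeInFilt`** (`im f_* ≤ max_X(b, s)`) and
  **`HodgeModel.iSup_range_complexGysin_le_maxRatSubHodgeInFilt`** — the whole Gysin span from
  `dim Y + s ≤ dim X` lies in `max_X(b, s)` (with the tree's `supportedClasses_eq_iSup_range_complexGysin` this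
  is the Gysin road to the tree's `HodgeModel.supportedClasses_le_maxRatSubHodgeInFilt`, `Nˢ Hᵇ ≤ max(b, s)`).
* §4 Transport of `GHC` along `f_*`: **`map_complexGysin_supportedClasses_le_of_add_eq_dim`**
  (`f_* Nᶜ Hᵃ(Y) ⊆ N^{c+s} Hᵇ(X)`, the tree's `complexGysin_mem_supportedClasses`) and
  **`GeneralHodgePropertyFor.map_complexGysin_le_supportedClasses`** — granted `GHC(Y, a, c)`, the Gysin
  image of every admissible subspace of `(Hᵃ(Y), Fᶜ)` is supported in codimension `c + s` on `X`.

## References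

* [Voisin2025] C. Voisin, Hodge and generalized Hodge conjectures, coniveau and algebraic cycles, J. Open Math.
  Probl. 1 (2025), §2.3 Def. 2.8, §4.1 (29) and Cor. 4.5 (ii).
* [VoisinHodgeI2002] C. Voisin, Hodge Theory and Complex Algebraic Geometry I, CUP 2002, §7.3.1 (7.5), §7.3.2
  (with Lemma 7.30).
* [GrothendieckTopology1969] A. Grothendieck, Hodge's general conjecture is false for trivial reasons, Topology 8
  (1969), §1 and p. 300.
-/

noncomputable section

open CategoryTheory AlgebraicGeometry Module
open Literature.AlgebraicTopology.SingularHomology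
open Literature.Geometry.Kaehler
open Literature.AlgebraicGeometry.Motives (IsSmoothProjective ComplexPoints)

namespace Literature.AlgebraicGeometry.HodgeTheory

variable {m n : ℕ} {Y X : Motives.SchemeOver ℂ}

/-! ### §1 `f_*` has bidegree `(s, s)` for `dim Y + s = dim X` -/

/-- **`f_*` maps type `(p, q)` on `Y` to type `(p + s, q + s)` on `X`** for a morphism `f : Y ⟶ X` of smooth
projective complex varieties with `dim Y + s = dim X` («`φ_*` … maps `H^{p,q}(Y)` to `H^{p+c,q+c}(X)`»; the
tree's `isOfHodgeType_complexGysin_of_cupPreservesHodgeType` fed with Hodge models of `Y` and `X`,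
`cupPreservesHodgeType_of_hodgeModel` and `hodgePQ_independent_of_hodgeModel_holds`).
[cite: Voisin2025, §4.1 (29) and §2.3 Def. 2.8] [cite: VoisinHodgeI2002, §7.3.2 (with Lemma 7.30)] -/
theorem isOfHodgeType_complexGysin_of_add_eq_dim (hY : IsSmoothProjective m Y) (hX : IsSmoothProjective n X)
    (f : Y ⟶ X) {s : ℕ} (hs : m + s = n) {a b : ℕ} (hab : a + 2 * n = b + 2 * m) {p q : ℕ}
    {y : complexBetti Y a} (hy : IsOfHodgeType m Y a p q y) :
    IsOfHodgeType n X b (p + s) (q + s) (complexGysin complexOrientationFamily hY hX f hab y) := by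
  obtain ⟨B⟩ := nonempty_hodgeModel_holds (n := m) (X := Y) hY
  obtain ⟨A⟩ := nonempty_hodgeModel_holds (n := n) (X := X) hX
  exact isOfHodgeType_complexGysin_of_cupPreservesHodgeType hodgePQ_independent_of_hodgeModel_holds
    complexOrientationFamily hY hX B A (cupPreservesHodgeType_of_hodgeModel hY B)
    (cupPreservesHodgeType_of_hodgeModel hX A) f hab (by omega) (by omega) hy

/-! ### §2 Admissible subspaces of `(Hᵃ(Y), Fᶜ)` go to admissible subspaces of `(Hᵇ(X), F^{c+s})` -/

/-- **`f_*` of a sub-Hodge structure is a sub-Hodge structure** (`dim Y + s = dim X`; the piece of type `(p, q)`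
goes to type `(p + s, q + s)`; the tree's `HodgeModel.IsSubHodge.map_of_hodgePQ`).
[cite: VoisinHodgeI2002, §7.3.1 (7.5) and §7.3.2] [cite: Voisin2025, §4.1] -/
theorem HodgeModel.IsSubHodge.map_complexGysin_of_add_eq_dim (B : HodgeModel m Y) (A : HodgeModel n X)
    (hY : IsSmoothProjective m Y) (hX : IsSmoothProjective n X) (f : Y ⟶ X) {s : ℕ} (hs : m + s = n)
    {a b : ℕ} (hab : a + 2 * n = b + 2 * m) {W : Submodule ℂ (complexBetti Y a)}
    (hW : B.IsSubHodge a (W.map (B.pullback a).hom)) :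
    A.IsSubHodge b ((W.map (complexGysin complexOrientationFamily hY hX f hab)).map (A.pullback b).hom) := by
  refine hW.map_of_hodgePQ B A _ fun p q hpq ↦ ⟨p + s, q + s, by omega, fun y hy ↦ ?_⟩
  exact (isOfHodgeType_iff_mem_hodgePQ hX A _).1 (isOfHodgeType_complexGysin_of_add_eq_dim hY hX f hs hab
    ((isOfHodgeType_iff_mem_hodgePQ hY B y).2 hy))

/-- **`f_* Fᶜ Hᵃ(Y) ⊆ F^{c+s} Hᵇ(X)`** (`dim Y + s = dim X`) for the Hodge filtrations read on `H(−(ℂ); ℂ)` through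
Hodge models `B` of `Y`, `A` of `X`: on `H^{p,q}(Y)` with `p ≥ c`, `f_*` lands in `H^{p+s,q+s}(X) ⊆ F^{c+s}`.
[cite: VoisinHodgeI2002, §7.3.2 and §7.1.1] [cite: Voisin2025, §4.1 and §2.3 Def. 2.8] -/
theorem HodgeModel.map_complexGysin_hodgeFiltrationBetti_le_of_add_eq_dim (B : HodgeModel m Y)
    (A : HodgeModel n X) (hY : IsSmoothProjective m Y) (hX : IsSmoothProjective n X) (f : Y ⟶ X) {s : ℕ}
    (hs : m + s = n) {a b : ℕ} (hab : a + 2 * n = b + 2 * m) (c : ℕ) :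
    (B.hodgeFiltrationBetti a c).map (complexGysin complexOrientationFamily hY hX f hab) ≤
      A.hodgeFiltrationBetti b (c + s) := by
  rintro _ ⟨x, hx, rfl⟩
  rw [SetLike.mem_coe, HodgeModel.mem_hodgeFiltrationBetti] at hx
  let S : Submodule ℂ (singularCohomology ℂ ℂ B.carrier a) :=
    ((A.hodgeFiltrationBetti b (c + s)).comap (complexGysin complexOrientationFamily hY hX f hab)).map
      (B.pullback a).hom
  have hle : B.hodgeFiltration a c ≤ S := by
    refine iSup_le fun p ↦ iSup_le fun q ↦ iSup_le fun hpq ↦ iSup_le fun hcp ↦ fun z hz ↦ ?_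
    obtain ⟨x₀, rfl⟩ := B.pullback_surjective a z
    refine ⟨x₀, ?_, rfl⟩
    change complexGysin complexOrientationFamily hY hX f hab x₀ ∈ A.hodgeFiltrationBetti b (c + s)
    rw [HodgeModel.mem_hodgeFiltrationBetti]
    exact A.hodgePQ_le_hodgeFiltration (show (p + s) + (q + s) = b by omega) (by omega)
      ((isOfHodgeType_iff_mem_hodgePQ hX A _).1
        (isOfHodgeType_complexGysin_of_add_eq_dim hY hX f hs hab ((isOfHodgeType_iff_mem_hodgePQ hY B x₀).2 hz)))
  obtain ⟨x', hx', hxx'⟩ := hle hx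
  obtain rfl : x' = x := B.pullback_injective a hxx'
  exact hx'

/-- **`f_*` of an admissible subspace of `(Hᵃ(Y), Fᶜ)` is an admissible subspace of `(Hᵇ(X), F^{c+s})`**
(`dim Y + s = dim X`, `b = a + 2s`: rationally spanned — `IsRationallySpanned.map_complexGysin`, any morphism —,
sub-Hodge, in the raised filtration). [cite: VoisinHodgeI2002, §7.3.1 (7.5) and §7.3.2] [cite: Voisin2025, §4.1]
[cite: GrothendieckTopology1969, p. 300] -/
theorem HodgeModel.complexGysin_map_mem_ratSubHodgeInFilt_of_add_eq_dim (B : HodgeModel m Y)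
    (A : HodgeModel n X) (hY : IsSmoothProjective m Y) (hX : IsSmoothProjective n X) (f : Y ⟶ X) {s : ℕ}
    (hs : m + s = n) {a b : ℕ} (hab : a + 2 * n = b + 2 * m) {c : ℕ} {W : Submodule ℂ (complexBetti Y a)}
    (hW : W ∈ B.ratSubHodgeInFilt a c) :
    W.map (complexGysin complexOrientationFamily hY hX f hab) ∈ A.ratSubHodgeInFilt b (c + s) :=
  ⟨hW.1.map_complexGysin hY hX f hab, hW.2.1.map_complexGysin_of_add_eq_dim B A hY hX f hs hab,
    (Submodule.map_mono hW.2.2).trans (B.map_complexGysin_hodgeFiltrationBetti_le_of_add_eq_dim A hY hX f hs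
      hab c)⟩

/-- **`f_* max_Y(a, c) ≤ max_X(b, c + s)`** (`dim Y + s = dim X`, `b = a + 2s`): the Gysin image of Grothendieck's
largest rational sub-Hodge structure of `Hᵃ(Y(ℂ); ℂ)` in `Fᶜ` lies in that of `Hᵇ(X(ℂ); ℂ)` in `F^{c+s}`.
[cite: GrothendieckTopology1969, p. 300] [cite: Voisin2025, §4.1] -/
theorem HodgeModel.map_complexGysin_maxRatSubHodgeInFilt_le_of_add_eq_dim (B : HodgeModel m Y)
    (A : HodgeModel n X) (hY : IsSmoothProjective m Y) (hX : IsSmoothProjective n X) (f : Y ⟶ X) {s : ℕ}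
    (hs : m + s = n) {a b : ℕ} (hab : a + 2 * n = b + 2 * m) (c : ℕ) :
    (B.maxRatSubHodgeInFilt a c).map (complexGysin complexOrientationFamily hY hX f hab) ≤
      A.maxRatSubHodgeInFilt b (c + s) :=
  A.le_maxRatSubHodgeInFilt (B.complexGysin_map_mem_ratSubHodgeInFilt_of_add_eq_dim A hY hX f hs hab
    (B.maxRatSubHodgeInFilt_mem a c))

/-! ### §3 `im f_*` is a rational sub-Hodge structure of Hodge coniveau `≥ s` -/

/-- **VOISIN §4.1 ON THE CARRIERS: `im(f_* : Hᵃ(Y(ℂ); ℂ) → Hᵇ(X(ℂ); ℂ))` is an admissible subspace of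
`(Hᵇ(X), Fˢ)`** for `f : Y ⟶ X` with `dim Y + s = dim X` — rationally spanned, a sub-Hodge structure, inside
`Fˢ` («`L := Im φ_*` … is a Hodge substructure with `L^{p′,q′} = 0` if `p′ < c` or `q′ < c`. Hence `L` has Hodge
coniveau `≥ c`»): all of `Hᵃ(Y)` is admissible for `(Hᵃ(Y), F⁰)` (the tree's
`HodgeModel.top_mem_ratSubHodgeInFilt_zero`) and §2. [cite: Voisin2025, §4.1 (29)]
[cite: VoisinHodgeI2002, §7.3.2] -/
theorem HodgeModel.range_complexGysin_mem_ratSubHodgeInFilt (A : HodgeModel n X) (hY : IsSmoothProjective m Y)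
    (hX : IsSmoothProjective n X) (f : Y ⟶ X) {s : ℕ} (hs : m + s = n) {a b : ℕ}
    (hab : a + 2 * n = b + 2 * m) :
    LinearMap.range (complexGysin complexOrientationFamily hY hX f hab) ∈ A.ratSubHodgeInFilt b s := by
  obtain ⟨B⟩ := nonempty_hodgeModel_holds (n := m) (X := Y) hY
  have h := B.complexGysin_map_mem_ratSubHodgeInFilt_of_add_eq_dim A hY hX f hs hab
    (B.top_mem_ratSubHodgeInFilt_zero hY a)
  rwa [Submodule.map_top, zero_add] at h

/-- **`im f_* ≤ max_X(b, s)`** for `f : Y ⟶ X` with `dim Y + s = dim X`: Gysin images from codimension-`s`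
sources lie in Grothendieck's largest rational sub-Hodge structure of `Hᵇ(X(ℂ); ℂ)` in `Fˢ`.
[cite: Voisin2025, §4.1 and Cor. 4.5 (ii)] [cite: GrothendieckTopology1969, p. 300] -/
theorem HodgeModel.range_complexGysin_le_maxRatSubHodgeInFilt (A : HodgeModel n X) (hY : IsSmoothProjective m Y)
    (hX : IsSmoothProjective n X) (f : Y ⟶ X) {s : ℕ} (hs : m + s = n) {a b : ℕ}
    (hab : a + 2 * n = b + 2 * m) :
    LinearMap.range (complexGysin complexOrientationFamily hY hX f hab) ≤ A.maxRatSubHodgeInFilt b s :=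
  A.le_maxRatSubHodgeInFilt (A.range_complexGysin_mem_ratSubHodgeInFilt hY hX f hs hab)

/-- **The whole Gysin span from `dim Y + s ≤ dim X` lies in `max_X(b, s)`**: the span of the images
`g_* Hᵃ(Y(ℂ); ℂ)` over all morphisms `g : Y ⟶ X` from smooth projective `Y` with `dim Y + s ≤ dim X` (which is
`Nˢ Hᵇ(X(ℂ); ℂ)` by the tree's `supportedClasses_eq_iSup_range_complexGysin`; so this is the Gysin road to the
tree's `HodgeModel.supportedClasses_le_maxRatSubHodgeInFilt`). [cite: Voisin2025, §4.1 Cor. 4.5 (ii)]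
[cite: GrothendieckTopology1969, §1 and p. 300] -/
theorem HodgeModel.iSup_range_complexGysin_le_maxRatSubHodgeInFilt (A : HodgeModel n X)
    (hX : IsSmoothProjective n X) (b s : ℕ) :
    (⨆ (m : ℕ) (_ : m + s ≤ n) (Y : Motives.SchemeOver ℂ) (hY : IsSmoothProjective m Y) (g : Y ⟶ X) (a : ℕ)
        (hab : a + 2 * n = b + 2 * m), LinearMap.range (complexGysin complexOrientationFamily hY hX g hab)) ≤
      A.maxRatSubHodgeInFilt b s := by
  refine iSup_le fun m ↦ iSup_le fun hm ↦ iSup_le fun Y ↦ iSup_le fun hY ↦ iSup_le fun g ↦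
    iSup_le fun a ↦ iSup_le fun hab ↦ ?_
  exact (A.range_complexGysin_le_maxRatSubHodgeInFilt hY hX g (s := n - m) (by omega) hab).trans
    (A.maxRatSubHodgeInFilt_mono b (by omega))

/-! ### §4 Transport of `GHC` along `f_*` -/

/-- **`f_* Nᶜ Hᵃ(Y(ℂ); ℂ) ⊆ N^{c+s} Hᵇ(X(ℂ); ℂ)`** for `f : Y ⟶ X` with `dim Y + s = dim X` (a class dying off a
closed `Z ⊆ Y` of codimension `≥ c` is sent to a class dying off the closed `f(Z)`, of codimension `≥ c + s` in
`X`; the tree's `complexGysin_mem_supportedClasses` with the proved support property of Gysin maps).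
[cite: Voisin2025, §4.1 Cor. 4.5] [cite: GrothendieckTopology1969, §1] -/
theorem map_complexGysin_supportedClasses_le_of_add_eq_dim (hY : IsSmoothProjective m Y)
    (hX : IsSmoothProjective n X) (f : Y ⟶ X) {s : ℕ} (hs : m + s = n) {a b : ℕ}
    (hab : a + 2 * n = b + 2 * m) (c : ℕ) :
    (supportedClasses Y a c).map (complexGysin complexOrientationFamily hY hX f hab) ≤
      supportedClasses X b (c + s) := by
  rintro _ ⟨y, hy, rfl⟩
  exact complexGysin_mem_supportedClasses (gysinMap_restrictCompl_eq_zero_of_field ℂ)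
    complexOrientationFamily hasPoincareDuality_complexOrientationFamily hY hX f hab (r := c) (s := c + s)
    (by omega) hy

/-- **Granted `GHC(Y, a, c)`, the Gysin image of every admissible subspace of `(Hᵃ(Y), Fᶜ)` along
`f : Y ⟶ X`, `dim Y + s = dim X`, is supported in codimension `c + s` on `X`.** [cite: Voisin2025, §4.1–§4.2]
[cite: GrothendieckTopology1969, p. 300] -/
theorem GeneralHodgePropertyFor.map_complexGysin_le_supportedClasses {a c : ℕ}
    (hG : GeneralHodgePropertyFor m Y a c) (B : HodgeModel m Y) (hY : IsSmoothProjective m Y)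
    (hX : IsSmoothProjective n X) (f : Y ⟶ X) {s : ℕ} (hs : m + s = n) {b : ℕ} (hab : a + 2 * n = b + 2 * m)
    {W : Submodule ℂ (complexBetti Y a)} (hW : W ∈ B.ratSubHodgeInFilt a c) :
    W.map (complexGysin complexOrientationFamily hY hX f hab) ≤ supportedClasses X b (c + s) :=
  (Submodule.map_mono (hG.2 B W hW)).trans (map_complexGysin_supportedClasses_le_of_add_eq_dim hY hX f hs hab c)

/-- **Granted `GHC(X, b, c + s)`, the Gysin image of `max_Y(a, c)` along `f : Y ⟶ X`, `dim Y + s = dim X`, is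
supported in codimension `c + s` on `X`** (it lies in `max_X(b, c + s)`, §2). [cite: Voisin2025, §4.1–§4.2]
[cite: GrothendieckTopology1969, p. 300] -/
theorem GeneralHodgePropertyFor.map_complexGysin_maxRatSubHodgeInFilt_le_supportedClasses {b c s : ℕ}
    (hG : GeneralHodgePropertyFor n X b (c + s)) (B : HodgeModel m Y) (A : HodgeModel n X)
    (hY : IsSmoothProjective m Y) (hX : IsSmoothProjective n X) (f : Y ⟶ X) (hs : m + s = n) {a : ℕ}
    (hab : a + 2 * n = b + 2 * m) :
    (B.maxRatSubHodgeInFilt a c).map (complexGysin complexOrientationFamily hY hX f hab) ≤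
      supportedClasses X b (c + s) :=
  (B.map_complexGysin_maxRatSubHodgeInFilt_le_of_add_eq_dim A hY hX f hs hab c).trans
    ((generalHodgePropertyFor_iff_of_hodgeModel A hX b (c + s)).1 hG)

end Literature.AlgebraicGeometry.HodgeTheory

end
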